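import Summits.BirchSwinnertonDyer.BirchSwinnertonDyer.Theses.SemiOrdinaryEisensteinDescent
import Summits.BirchSwinnertonDyer.BirchSwinnertonDyer.Theorems.SemiOrdinaryEisensteinDescentJetchevMaxDivisibilityAtThreeModThreeOfMiddleExact
import Summits.BirchSwinnertonDyer.BirchSwinnertonDyer.Theorems.SchneiderFreeAdditiveX3PoitouTateReciprocitySumHolds
import HarnessLib

/-!
# Route `SemiOrdinaryEisensteinDescent` (rev 25), support item `JetchevMaxDivisibilityAtThreeModThree` (stmt-BirchSwinnertonDyer-25897)
# — Jetchev's max-form σ-divisibility at `3 ∣ N` under `ρ̄₃` onto, modulo the two Gross 1991 primitives — PROVED AS TYPED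

Cell `bsd-wall` (W-ALL row 2·3@3, SOED Kolyvagin column), width seat `bsd-wall-soed-p2-w3` (gen 6), 2026-08-28.

THE ITEM. `JetchevMaxDivisibilityAtThreeModThree := PoitouTateSelmerStructureDualityFact → GrossHeegnerPointE0Input →
GrossProp372FrobeniusCongruenceInput → hJmax` (tree debt, typed conditional by the pen at act G rev 18): Jetchev 2008 Thm. 1.4 /
Cor. 1.5 read modulo `3` at the maximal Tamagawa carriers, `ρ̄₃` onto ONLY, no tower — on every odd-`d_K` Heegner frame of the wild cell
and every `q ∣ N`, the Kolyvagin points are `3`-divisible to depth `ord₃ c_q(E/ℚ_q)` (`Koly.PDiv`).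

WHY IT WAS OPEN (vets' finding G1, bsd-vet-tk5i g2/g3; soed-p2-w2 g5/g6 `Cruxes/WildKolyvaginUpperAtThree/PT-INPUT-w2g6.md`): the tree's
proof of `hJmax` (`WildKolyvaginUpperAtThreeTowerFreeJetchevMaxModThree.jetchevMaxModThree_of_literature`, the JET ModP series = Jetchev
Thm. 5.1 sign by sign on the `τ`-eigenspaces) needs the FIVE-conjunct Poitou–Tate fact for Selmer structures (with the conjugation
compatibility of the local invariant maps), while the item's antecedent is the abstract FOUR-conjunct fact (`∃` a family with four
properties), from which the five-conjunct one does not follow without a rigidity statement (one-place Grunwald–Wang over `K`). So the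
item was closable only conditionally (p608444 `…OfDualityConj`, p610376-successor `…OfMiddleExact`: ⟸ `∀ K n,
(LocalInvariants.canonical K n).SelmerComplement`), and the route took the five-conjunct input BY NAME (23092) through the glue 26257.

WHAT CHANGED (2026-08-28T10:21Z). Cell bsd-schneider's Route A (door-c4/c5/c6 g17–g18) landed Poitou–Tate duality for Selmer structures
for EVERY number field (`SchneiderFreeAdditiveX3.PoitouTateReduction.poitouTate_selmerStructure_duality_holds`, p624636) and Howard's
complement property for THE canonical family at every level (`selmerComplement_canonical_holds`, p626891), by the E-side idèle package of the
presentation road (Milne *ADT* I Thm. 4.10 (b) proof, Cassels–Fröhlich VII §11). Feeding the latter to w2 g6's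
`jetchevMaxDivisibilityAtThreeModThree_of_selmerComplementCanonical` proves the item AS TYPED — its own four-conjunct antecedent is simply
not used (it is itself a theorem now, item 20461 CLOSED by p625477), the rigidity gap is moot.

HONEST FRAMING. This closes a SUPPORT item: Jetchev's max-form divisibility at the wild prime `3` MODULO the two Gross 1991 primitives
that remain Literature named facts inside the item's own statement — `Gross1991_heegnerPoint_sub_ratTorsion_mem_E0` (GZ86 III (3.1)) and
`GrossLMS1991.prop37_2_frobeniusCongruence` (Prop. 3.7 (2)) — both undischarged (items 24701 / 23091). The duality input is no longer
print anywhere in the SOED Kolyvagin column. The research cruxes E_𝟙^V (26610), J‴ (25898), Z (20387) are untouched; nothing about any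
curve is asserted unconditionally; no case of Poitou–Tate duality is proved IN THIS FILE (it is consumed by name). BSD is not proved by
this file.
-/

set_option autoImplicit false
set_option linter.dupNamespace false -- `Summit.BirchSwinnertonDyer.BirchSwinnertonDyer.…` is the tree's layout (D-0017)

noncomputable section

open scoped Classical

namespace Summit.BirchSwinnertonDyer.BirchSwinnertonDyer.Theorems

open Summit.BirchSwinnertonDyer.BirchSwinnertonDyer.Theses.SemiOrdinaryEisensteinDescent
open Summit.BirchSwinnertonDyer.BirchSwinnertonDyer.Theorems.SchneiderFreeAdditiveX3.PoitouTateReduction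

/-- **Item `JetchevMaxDivisibilityAtThreeModThree` (stmt-BirchSwinnertonDyer-25897), PROVED AS TYPED**: Jetchev's max-form
σ-divisibility at `3 ∣ N` under `ρ̄₃` onto, from the item's own Gross 1991 antecedents (E⁰ membership, Prop. 3.7 (2)); its
four-conjunct Poitou–Tate antecedent is ignored — the duality input of the JET ModP chain (the five-conjunct fact at every number field)
is supplied by cell bsd-schneider's `selmerComplement_canonical_holds` (Howard 2004 Thm. 2.1.11 for THE canonical invariant maps, every
`K`, `n`) through w2 g6's `jetchevMaxDivisibilityAtThreeModThree_of_selmerComplementCanonical` (IsPerfect, reciprocity, Milne I 2.6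
and conjugation compatibility of THE maps being kernel theorems). [cite: Jetchev2008, Thm. 1.4 (p. 812) and Thm. 5.1]
[cite: MilneADT2006, Ch. I, Cor. 2.3, Thm. 2.6, Thm. 4.10(b)] [cite: Howard2004HeegnerKolyvagin, Thm. 2.1.11 (arXiv:1202.6340 p. 6)]
[cite: GrossLMS1991, Prop. 3.7 (2) p. 240 and §6 p. 245] -/
theorem semiOrdinaryEisensteinDescent_jetchevMaxDivisibilityAtThreeModThree_proof : JetchevMaxDivisibilityAtThreeModThree :=
  JetchevMaxDivisibilityAtThreeModThreeOfMiddleExact.jetchevMaxDivisibilityAtThreeModThree_of_selmerComplementCanonical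
    fun K _ _ n _ ↦ selmerComplement_canonical_holds K n

end Summit.BirchSwinnertonDyer.BirchSwinnertonDyer.Theorems

end
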